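import Literature.NumberTheory.GaloisRepresentations.FrobeniusPairZetaEulerProduct
import Literature.NumberTheory.DiophantineGeometry.FunctionFieldZetaRationalityProofs
import HarnessLib

/-!
# The zeta function of a pair `(F, σ)`, II: rationality, `L^σ(1) = h^σ`, and the logarithmic derivative

Topic `Literature/NumberTheory/GaloisRepresentations`; **proof file** (theorems only; D-0014/D-0026: no
definitions, no named facts).  Sequel of `FrobeniusInvariantDivisors` and `FrobeniusPairZetaEulerProduct`.

**Setting.** `F/Ω` an algebraic function field over an algebraically closed field `Ω`, `G` acting on `F`
stabilising `Ω`, `σ ∈ G` a `q`-Frobenius on the constants (`σ c = c^q`, `q = #k` for a finite field `k ⊆ Ω`),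
every place `σ`-periodic, the places fixed by each `σ^s` (`s ≥ 1`) finite in number, and some place fixed by
`σ`.  Write `A_n^σ` for the number of `σ`-invariant positive divisors of degree `n`, `N_r^σ = #{P : σ^r P = P}`,
`h^σ = #{c ∈ Cl(F/Ω) : deg c = 0, σ c = c}`, `Z^σ(t) = ∑ A_n^σ tⁿ`.

**Results** (Stichtenoth §5.1 and Milne's proof of *Jacobian varieties* Thm. 11.1, run for the pair):

* `PairZeta.exists_polynomial` (pure algebra, namespace `PairZeta`) — a sequence with `A₀ = 1` and
  `(q - 1) A_n = h (q^{n+1-g} - 1)` for `n > 2g - 2` has `(1 - t)(1 - qt) ∑ A_n tⁿ = L(t)` a polynomial of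
  degree `≤ 2g` with `L(1) = h` (Stichtenoth (5.12), Lemma 5.1.4 (c) ⇒ Thm. 5.1.15 (a), (c), abstractly).
* `X_mul_derivative_mk_eq_of_rec` — `t Z' = Z N` from `n A_n = ∑_{r=1}^{n} N_r A_{n-r}`.
* `pairZeta_rec` — `(q - 1) A_n^σ = h^σ (q^{n+1-g} - 1)` for `n > 2g - 2` (`FrobeniusInvariantDivisors`).
* `exists_pairLPolynomial` — **`L^σ(t) := (1 - t)(1 - qt) Z^σ(t)` is a polynomial of degree `≤ 2g` with
  `L^σ(1) = h^σ`.**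
* `X_mul_derivative_pairZeta` — **`t (Z^σ)' = Z^σ · ∑_{r ≥ 1} N_r^σ t^r`** (the Euler product of the pair).

For `F = Ω(C)`, `σ = φ^r`, `k = 𝔽_{q^r}`: `h^σ = #Pic⁰(C_Ω)^{φ^r}` (`= #J(𝔽_{q^r})`) and `N_s^σ = N_{rs}(C)`, so that
comparing logarithmic derivatives with the `L`-polynomial of `C/𝔽_q` gives `h^σ = ∏ᵢ (1 - αᵢ^r)`
(`SuperellipticFrobeniusClassNumber` for the curves `y^p = f(x)`).

## References
* H. Stichtenoth, *Algebraic Function Fields and Codes*, 2nd ed., GTM 254 (2009), Lemma 5.1.4, Prop. 5.1.8,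
  eq. (5.12), Thm. 5.1.15. [Stichtenoth2009]
* J. S. Milne, *Jacobian varieties*, in: Arithmetic Geometry (Cornell–Silverman eds.), Springer (1986), §11,
  Thm. 11.1 and its proof. [Milne1986JacobianVarieties]
* M. Rosen, *Number Theory in Function Fields*, GTM 210 (2002), Thm. 5.9, Ch. 5 proof of Thm. 5.12, Ch. 8.
  [RosenFunctionFields2002]
-/

noncomputable section

open scoped Classical

namespace Literature.NumberTheory.GaloisRepresentations

open Literature.NumberTheory.DiophantineGeometry Literature.NumberTheory.DiophantineGeometry.AlgFunctionField

universe u v w x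

/-! ### Sequences with `A_n (q - 1) = h (q^{n+1-g} - 1)` for `n > 2g - 2`: the series `(1-t)(1-qt) ∑ A_n tⁿ` is a
polynomial of degree `≤ 2g` with value `h` at `t = 1` (Stichtenoth Lemma 5.1.4 ⇒ Thm. 5.1.15 (a), (c), abstractly) -/

namespace PairZeta

open PowerSeries

variable (A : ℕ → ℤ) (q : ℤ)

/-- `(1 - (q+1) t + q t²) ∑ A_n tⁿ`: the coefficient of `t` is `A₁ - (q + 1) A₀`. [cite: Stichtenoth2009, eq. (5.12)] -/
theorem coeff_one_eq : PowerSeries.coeff 1 ((1 - X) * (1 - PowerSeries.C q * X) * PowerSeries.mk A) =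
    A 1 - (q + 1) * A 0 := by
  have h : (1 - X) * (1 - PowerSeries.C q * X) * PowerSeries.mk A =
      (1 - PowerSeries.C (q + 1) * X + PowerSeries.C q * X ^ 2) * PowerSeries.mk A := by
    ring_nf; simp [map_add]; ring
  rw [h, add_mul, sub_mul, one_mul, map_add, map_sub, mul_assoc, coeff_C_mul,
    show (1 : ℕ) = 0 + 1 from rfl, coeff_succ_X_mul, mul_assoc, coeff_C_mul, coeff_X_pow_mul']
  simp

/-- `(1 - (q+1) t + q t²) ∑ A_n tⁿ`: for `n ≥ 0` the coefficient of `t^{n+2}` is `A_{n+2} - (q + 1) A_{n+1} + q A_n`.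
[cite: Stichtenoth2009, eq. (5.12)] -/
theorem coeff_add_two_eq (n : ℕ) :
    PowerSeries.coeff (n + 2) ((1 - X) * (1 - PowerSeries.C q * X) * PowerSeries.mk A) =
      A (n + 2) - (q + 1) * A (n + 1) + q * A n := by
  have h : (1 - X) * (1 - PowerSeries.C q * X) * PowerSeries.mk A =
      (1 - PowerSeries.C (q + 1) * X + PowerSeries.C q * X ^ 2) * PowerSeries.mk A := by
    ring_nf; simp [map_add]; ring
  rw [h, add_mul, sub_mul, one_mul, map_add, map_sub, mul_assoc, coeff_C_mul,
    show n + 2 = (n + 1) + 1 from rfl, coeff_succ_X_mul, mul_assoc, coeff_C_mul, coeff_X_pow_mul']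
  simp

/-- **Telescoping**: `∑_{m=0}^{M+1} (coefficient of t^m) = A_{M+1} - q A_M`. [cite: Stichtenoth2009, eq. (5.12)] -/
theorem sum_range_coeff_eq (M : ℕ) :
    ∑ m ∈ Finset.range (M + 2), PowerSeries.coeff m ((1 - X) * (1 - PowerSeries.C q * X) * PowerSeries.mk A) =
      A (M + 1) - q * A M := by
  induction M with
  | zero =>
    rw [Finset.sum_range_succ, Finset.sum_range_succ, Finset.sum_range_zero, zero_add,
      PowerSeries.coeff_zero_eq_constantCoeff, coeff_one_eq]
    simp
    ring
  | succ M ih =>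
    rw [Finset.sum_range_succ, ih, show M + 1 + 1 = M + 2 from rfl, coeff_add_two_eq]
    ring

variable {A q} {h : ℤ} {g : ℕ}

/-- `g = 0` forces `h = 1` (the relation at `n = 0`: `A₀ (q - 1) = h (q - 1)` with `A₀ = 1`).
[cite: Stichtenoth2009, Prop. 5.1.6 (a) (proof)] -/
theorem h_eq_one (hq : 1 < q) (hA0 : A 0 = 1)
    (hrec : ∀ n : ℕ, 2 * g < n + 2 → (q - 1) * A n = h * (q ^ (n + 1 - g) - 1)) (hg : g = 0) : h = 1 := by
  have h0 := hrec 0 (by omega)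
  rw [hA0, hg, Nat.sub_zero, zero_add, pow_one, mul_one] at h0
  have hne : q - 1 ≠ 0 := by linarith
  exact (mul_right_cancel₀ hne (by linarith)).symm

/-- **The coefficients beyond `t^{2g}` vanish.** [cite: Stichtenoth2009, Thm. 5.1.15 (a) (proof)] -/
theorem coeff_eq_zero (hq : 1 < q) (hA0 : A 0 = 1)
    (hrec : ∀ n : ℕ, 2 * g < n + 2 → (q - 1) * A n = h * (q ^ (n + 1 - g) - 1)) {m : ℕ} (hm : 2 * g < m) :
    PowerSeries.coeff m ((1 - X) * (1 - PowerSeries.C q * X) * PowerSeries.mk A) = 0 := by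
  have hqne : q - 1 ≠ 0 := by linarith
  rcases m with _ | _ | n
  · omega
  · -- `m = 1`, so `g = 0` and `h = 1`
    have hg : g = 0 := by omega
    have hh := h_eq_one hq hA0 hrec hg
    have hA1 := hrec 1 (by omega)
    rw [hh, hg, one_mul, Nat.sub_zero] at hA1
    apply mul_left_cancel₀ hqne
    rw [coeff_one_eq, hA0, mul_zero, mul_sub, hA1]
    ring
  · have hA0' := hrec n (by omega)
    have hA1 := hrec (n + 1) (by omega)
    have hA2 := hrec (n + 2) (by omega)
    have e1 : n + 1 + 1 - g = (n + 1 - g) + 1 := by omega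
    have e2 : n + 2 + 1 - g = (n + 1 - g) + 2 := by omega
    rw [e1, pow_succ] at hA1
    rw [e2, pow_add] at hA2
    apply mul_left_cancel₀ hqne
    rw [coeff_add_two_eq, mul_zero]
    linear_combination hA2 - (q + 1) * hA1 + q * hA0'

/-- **`A_{M+1} - q A_M = h` for `M ≥ 2g`.** [cite: Stichtenoth2009, Lemma 5.1.4 (c)] -/
theorem succ_sub_mul_eq (hq : 1 < q)
    (hrec : ∀ n : ℕ, 2 * g < n + 2 → (q - 1) * A n = h * (q ^ (n + 1 - g) - 1)) (M : ℕ) (hM : 2 * g ≤ M) :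
    A (M + 1) - q * A M = h := by
  have hA := hrec M (by omega)
  have hB := hrec (M + 1) (by omega)
  have hne : q - 1 ≠ 0 := by linarith
  have hexp : M + 1 + 1 - g = (M + 1 - g) + 1 := by omega
  rw [hexp, pow_succ] at hB
  apply mul_left_cancel₀ hne
  have key : (q - 1) * (A (M + 1) - q * A M) = (q - 1) * A (M + 1) - q * ((q - 1) * A M) := by ring
  rw [key, hA, hB]
  ring

/-- **Rationality and the value at `1`**: `(1 - t)(1 - qt) ∑ A_n tⁿ` is a polynomial `L` of degree `≤ 2g` with
`L(1) = h`. [cite: Stichtenoth2009, Thm. 5.1.15 (a), (c)] -/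
theorem exists_polynomial (hq : 1 < q) (hA0 : A 0 = 1)
    (hrec : ∀ n : ℕ, 2 * g < n + 2 → (q - 1) * A n = h * (q ^ (n + 1 - g) - 1)) :
    ∃ L : Polynomial ℤ, L.natDegree ≤ 2 * g ∧
      (L : PowerSeries ℤ) = (1 - X) * (1 - PowerSeries.C q * X) * PowerSeries.mk A ∧ L.eval 1 = h := by
  set Lz : PowerSeries ℤ := (1 - X) * (1 - PowerSeries.C q * X) * PowerSeries.mk A with hLz
  have hcoeff : ∀ m, (PowerSeries.trunc (2 * g + 1) Lz).coeff m = PowerSeries.coeff m Lz := fun m => by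
    rw [PowerSeries.coeff_trunc]
    split_ifs with hm
    · rfl
    · exact (coeff_eq_zero hq hA0 hrec (by omega)).symm
  have hdeg : (PowerSeries.trunc (2 * g + 1) Lz).natDegree < 2 * g + 1 := PowerSeries.natDegree_trunc_lt Lz (2 * g)
  refine ⟨PowerSeries.trunc (2 * g + 1) Lz, by omega, ?_, ?_⟩
  · ext m
    rw [Polynomial.coeff_coe, hcoeff]
  · have hdeg' : (PowerSeries.trunc (2 * g + 1) Lz).natDegree < 2 * g + 2 := by omega
    rw [Polynomial.eval_eq_sum_range' hdeg']
    simp only [one_pow, mul_one, hcoeff]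
    rw [sum_range_coeff_eq, succ_sub_mul_eq hq hrec (2 * g) le_rfl]

end PairZeta

/-! ### The logarithmic derivative from the recursion `n A_n = ∑_{r=1}^{n} N_r A_{n-r}` -/

section LogDeriv

open PowerSeries

/-- **`t Z'(t) = Z(t) · N(t)`** for `Z = ∑ A_n tⁿ`, `N = ∑ N_r t^r` with `N₀ = 0`, from the recursion
`n A_n = ∑_{r=1}^{n} N_r A_{n-r}` (the Euler product through its logarithmic derivative).
[cite: Stichtenoth2009, Prop. 5.1.8] [cite: RosenFunctionFields2002, Ch. 5, proof of Thm. 5.12] -/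
theorem X_mul_derivative_mk_eq_of_rec (A N : ℕ → ℤ) (hN0 : N 0 = 0)
    (hrec : ∀ n : ℕ, (n : ℤ) * A n = ∑ r ∈ Finset.Icc 1 n, N r * A (n - r)) :
    X * d⁄dX ℤ (PowerSeries.mk A) = PowerSeries.mk A * PowerSeries.mk N := by
  ext n
  rcases n with _ | n
  · simp [coeff_mul, hN0]
  · rw [coeff_succ_X_mul, coeff_derivative, coeff_mul,
      Finset.Nat.sum_antidiagonal_eq_sum_range_succ (fun i j => coeff i (PowerSeries.mk A) * coeff j (PowerSeries.mk N)) (n + 1)]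
    simp only [coeff_mk, Nat.succ_eq_add_one]
    rw [sum_range_mul_eq_sum_Icc_mul A N n hN0, mul_comm]
    exact_mod_cast hrec (n + 1)

end LogDeriv

/-! ### The zeta function of the pair `(F, σ)` -/

section PairZetaMain

open PowerSeries

attribute [local instance] Finsupp.comapSMul Finsupp.comapMulAction Finsupp.comapDistribMulAction
attribute [local instance] divisorClassDistribMulAction

variable {Ω : Type u} {F : Type v} [Field Ω] [Field F] [Algebra Ω F]
variable {G : Type w} [Group G] [MulSemiringAction G F] [IsConstantStable G Ω F]
variable [IsAlgFunctionField Ω F] [IsIntegrallyClosedIn Ω F] [IsAlgClosed Ω]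
variable {k : Type x} [Field k] [Finite k] [Algebra k Ω]
variable {σ : G} (hσ : ∀ c : Ω, σ • algebraMap Ω F c = algebraMap Ω F (c ^ Nat.card k))
variable (hper : ∀ P : PlaceOver Ω F, ∃ s, 0 < s ∧ (σ ^ s) • P = P)
  (hfin : ∀ s, 0 < s → Finite {P : PlaceOver Ω F // (σ ^ s) • P = P})

omit [IsIntegrallyClosedIn Ω F] [IsAlgClosed Ω] in
/-- `A₀^σ = 1`: the only positive divisor of degree `0` is `0`. [folklore] -/
theorem natCard_invariant_effective_degree_zero (σ : G) :
    Nat.card {A : Divisor Ω F // 0 ≤ A ∧ σ • A = A ∧ A.degree = ((0 : ℕ) : ℤ)} = 1 := by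
  rw [Nat.card_eq_one_iff_unique]
  refine ⟨⟨fun A B => Subtype.ext ?_⟩, ⟨⟨0, le_rfl, smul_zero σ, by simp⟩⟩⟩
  rw [Divisor.eq_zero_of_nonneg_of_degree_eq_zero A.2.1 (by exact_mod_cast A.2.2.2),
    Divisor.eq_zero_of_nonneg_of_degree_eq_zero B.2.1 (by exact_mod_cast B.2.2.2)]

include hσ hper hfin in
/-- **Stichtenoth Lemma 5.1.4 (c) for the pair `(F, σ)`**: with `h^σ = #{c : deg c = 0, σ c = c}` (the shift by a
`σ`-fixed place `P₀` identifies invariant classes of all degrees) and `q = #k`,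
`(q - 1) A_n^σ = h^σ (q^{n+1-g} - 1)` for `n > 2g - 2`. [cite: Stichtenoth2009, Lemma 5.1.4 (c)] -/
theorem pairZeta_rec {P₀ : PlaceOver Ω F} (hP₀ : σ • P₀ = P₀) (n : ℕ) (hn : 2 * genus Ω F < n + 2) :
    ((Nat.card k : ℤ) - 1) * Nat.card {A : Divisor Ω F // 0 ≤ A ∧ σ • A = A ∧ A.degree = n} =
      Nat.card {c : DivisorClass Ω F // DivisorClass.degree c = 0 ∧ σ • c = c} *
        ((Nat.card k : ℤ) ^ (n + 1 - genus Ω F) - 1) := by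
  rw [natCard_invariant_effective_degree_mul (k := k) hσ hn (finite_invariant_effective_degree σ hper hfin n),
    natCard_invariantClasses_eq σ hP₀ n]

include hσ hper hfin in
/-- **The `L`-polynomial of the pair `(F, σ)` and its value at `1`.**  Let `Z^σ(t) = ∑_n A_n^σ tⁿ`
(`A_n^σ` = number of `σ`-invariant positive divisors of `F/Ω` of degree `n`), `q = #k` and
`h^σ = #{c ∈ Cl(F/Ω) : deg c = 0, σ c = c}`; assume a `σ`-fixed place exists.  Then
`L^σ(t) := (1 - t)(1 - qt) Z^σ(t)` is a polynomial of degree `≤ 2g` and **`L^σ(1) = h^σ`** — Stichtenoth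
Thm. 5.1.15 (a), (c) for the pair, by Lemma 5.1.4 (c) for the pair (`pairZeta_rec`) and the telescoping of
(5.12).  For `F = Ω(C)`, `σ = φ^r`: `h^σ = #Pic⁰(C)(𝔽_{q^r})` and this is the identity `#J(𝔽_{q^r}) = h(C/𝔽_{q^r}) =
L_r(1)` entering Weil's determination of the characteristic polynomial of Frobenius (Milne, proof of Thm. 11.1).
[cite: Stichtenoth2009, Thm. 5.1.15 (a), (c)] [cite: Milne1986JacobianVarieties, §11 (proof of Thm. 11.1)] -/
theorem exists_pairLPolynomial {P₀ : PlaceOver Ω F} (hP₀ : σ • P₀ = P₀) :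
    ∃ L : Polynomial ℤ, L.natDegree ≤ 2 * genus Ω F ∧
      (L : PowerSeries ℤ) = (1 - PowerSeries.X) * (1 - PowerSeries.C (Nat.card k : ℤ) * PowerSeries.X) *
        PowerSeries.mk (fun n => (Nat.card {A : Divisor Ω F // 0 ≤ A ∧ σ • A = A ∧ A.degree = n} : ℤ)) ∧
      L.eval 1 = Nat.card {c : DivisorClass Ω F // DivisorClass.degree c = 0 ∧ σ • c = c} := by
  have hq : (1 : ℤ) < Nat.card k := by exact_mod_cast Finite.one_lt_card (α := k)
  exact PairZeta.exists_polynomial (g := genus Ω F) hq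
    (by exact_mod_cast natCard_invariant_effective_degree_zero (Ω := Ω) (F := F) σ)
    (fun n hn => pairZeta_rec hσ hper hfin hP₀ n hn)

include hper hfin in
omit [IsIntegrallyClosedIn Ω F] in
/-- **The Euler product of the pair: `t (Z^σ)'(t) = Z^σ(t) · ∑_{r ≥ 1} N_r^σ t^r`**, `N_r^σ = #{P : σ^r P = P}`
(`mul_natCard_invariant_effective_eq_sum` as an identity of formal power series).
[cite: Stichtenoth2009, Prop. 5.1.8] [cite: Milne1986JacobianVarieties, §11 (proof of Thm. 11.1)] -/
theorem X_mul_derivative_pairZeta :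
    PowerSeries.X * d⁄dX ℤ (PowerSeries.mk fun n => (Nat.card {A : Divisor Ω F // 0 ≤ A ∧ σ • A = A ∧ A.degree = n} : ℤ)) =
      (PowerSeries.mk fun n => (Nat.card {A : Divisor Ω F // 0 ≤ A ∧ σ • A = A ∧ A.degree = n} : ℤ)) *
        PowerSeries.mk fun r => if r = 0 then 0 else (Nat.card {P : PlaceOver Ω F // (σ ^ r) • P = P} : ℤ) := by
  refine X_mul_derivative_mk_eq_of_rec _ _ (if_pos rfl) fun n => ?_
  have h := mul_natCard_invariant_effective_eq_sum σ hper hfin n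
  apply_fun (fun x : ℕ => (x : ℤ)) at h
  push_cast at h
  rw [h]
  refine Finset.sum_congr rfl fun r hr => ?_
  rw [if_neg (by have := (Finset.mem_Icc.1 hr).1; omega)]

end PairZetaMain

end Literature.NumberTheory.GaloisRepresentations
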